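import Summits.BirchSwinnertonDyer.BirchSwinnertonDyer.Theorems.SignedLowerHalvesSmallImageLowerHalfBothSignsRttD2SpecialisationRegOfDef
import Summits.BirchSwinnertonDyer.BirchSwinnertonDyer.Theorems.SignedLowerHalvesSmallImageLowerHalfBothSignsRttCharRoadD2TorsionByReduction
import Summits.BirchSwinnertonDyer.BirchSwinnertonDyer.Theorems.SignedLowerHalvesSmallImageLowerHalfBothSignsRttD2UnitAuxIdeal
import Summits.BirchSwinnertonDyer.BirchSwinnertonDyer.Theorems.SignedLowerHalvesSmallImageLowerHalfBothSignsRttD2SpecialisationFreeRankOne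
import HarnessLib

/-!
# Route `SignedLowerHalves`, crux L `SmallImageLowerHalfBothSigns` (stmt-BirchSwinnertonDyer-23599), line `rtt_w3` v14 — E2: THE v15 CONSUMER.
# E2 from road D + the junction with the frame ASSEMBLED: `z := j₀ (sp¹ ζ̄_𝔞)`, `hz` from Poitou–Tate exactness, `hζ` from the unit `𝔞`, `hdef` from `H1[f] = 0`,
# `hreg` derived — the remaining binders are exactly the rows of BRIEF-E2 rev 5 (`Lines/rtt_w3-BRIEF-E2-g11.md`)

WHY (BRIEF-E2 rev 5 §1/§4, LEAD `cruxlead-stmt-BirchSwinnertonDyer-23599` g11). p780454's ★★★★ `charRoad_E2_of_roadD_junction_exact` carries, besides the glue data and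
the junction, SIX frame binders that are theorems of the other binders once the auxiliary ideal `𝔞` with `φ (N𝔞 − σ_𝔞) ∈ Λ_𝒪ˣ` is fixed (LEAD p782069 ∘ honda p781713 supply it
from the stub's binders): `ζ := zetaSp f D 𝔞` and `hζ` (g19 `map_mkQ_Z_eq_span_zetaSp_of_isUnit`), `z := j₀ (sp¹ ζ̄)` and `hz : gX z = 0` (exactness of `B → Q → X'`), `hjz`
(`rfl`), `hdef` (p777666 `torsionBy_quotient_Z_eq_bot_of_quotSMulTop_linearMap` from `H1[f] = 0`, `D.Z = D.cyclic 𝔞` — g19 `Z_eq_cyclic_of_isUnit` through LEAD g10's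
`isUnit_map_iff_isUnit_constantCoeff_constantCoeff` — and `eH ζ̄ = z ≠ 0`, itself from (an) + `hCol` as inside the glue), `hreg` (LEAD p782187). THIS FILE performs that assembly:
★★★★★ `charRoad_E2_of_roadD_junction_of_isUnit_nsub` — hypotheses = glue data (G) · frame: `b ∈ 𝔪_𝒪`, `φ`-clauses, honda's skeleton `D` with `Thm52Shape`, `H1[f] = 0` (⟸ `hTF`),
an index `a` with `IsUnit (φ (D.nsub a))`, the pinned structures · junction: `B`, `s = sp¹`, `htB`, `hcoker`, `j₀`, `hexact`, `hY` · `Col`, (an), `hCol` for `z := j₀ (s (zetaSp f D a))`.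
This is the consumer the v15 registry act will name (rev 5 §4: the ∃-tail loses `z`, `hz`, `hK`).

* `isUnit_of_isUnit_map` — `IsUnit (φ r) ⟹ IsUnit r` in `𝒪⟦T₂⟧⟦T₁⟧` for the inner evaluation at `b ∈ 𝔪_𝒪`;
* ★★★★★ `charRoad_E2_of_roadD_junction_of_isUnit_nsub` (the step `z ≠ 0` from `hCol` + (an) is re-run inline, as in the glue).

THEOREMS ONLY (`--supports stmt-BirchSwinnertonDyer-23599` helper); closes nothing; crux L, crux M, E2 and BSD remain OPEN and are proved for NO curve by any of this.
[cite: Kobayashi2003, Thm. 7.3 i), Thm. 1.3] [cite: JohnsonLeungKings2011, Thm. 5.2, Cor. 5.3, §5.2 (arXiv p0014:L100–105), §6.1] [cite: PollackRubin2004, §6–§7] [cite: Washington1997, §7.1 Prop. 7.2, §13.2]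
-/

set_option autoImplicit false
-- the Theorems namespace of this sub repeats the summit name by design (D-0017 nested layout)
set_option linter.dupNamespace false

noncomputable section
open scoped Pointwise Classical MatrixGroups ModularForm

open PowerSeries Literature.NumberTheory.Automorphic Literature.NumberTheory.EllipticCurves Literature.NumberTheory.EllipticCurves.Module
open Literature.NumberTheory.ComplexMultiplication.EllipticUnits.JohnsonLeungKings2011
open Summit.BirchSwinnertonDyer.BirchSwinnertonDyer.Theorems.SmallImageRttD2LamSpec
open Summit.BirchSwinnertonDyer.BirchSwinnertonDyer.Theorems.SmallImageRttD2Spec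
open Literature.NumberTheory.IwasawaTheory Literature.NumberTheory.EllipticCurves.GreenbergVatsal2000 CongruenceSubgroup NumberField
  IsDedekindDomain Rat.HeightOneSpectrum Literature.NumberTheory.EllipticCurves.ModularForms

namespace Summit.BirchSwinnertonDyer.BirchSwinnertonDyer.Theorems.SmallImageRttCharRoad

universe u v w w'

/-! ## §1 Two small exports -/

section Small

variable {p : ℕ} [Fact p.Prime] {S : Set (PadicAlgCl p)}

/-- **`IsUnit (φ r) ⟹ IsUnit r`** in `R = 𝒪⟦T₂⟧⟦T₁⟧` for the inner evaluation `φ` at `b ∈ 𝔪_𝒪` (`𝒪` local): both sides are read on the double constant term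
(LEAD g10 `isUnit_map_iff_isUnit_constantCoeff_constantCoeff`, Mathlib `PowerSeries.isUnit_iff_constantCoeff`). [cite: Washington1997, §7.1 Prop. 7.2] [folklore] -/
theorem isUnit_of_isUnit_map [IsLocalRing (padicCoeffIntegers S)] {b : padicCoeffIntegers S} (hb : b ∈ IsLocalRing.maximalIdeal (padicCoeffIntegers S))
    (φ : PowerSeries (IwasawaAlgebraO S) →+* IwasawaAlgebraO S) (hφf : φ (C (X - C b)) = 0) (hC : ∀ a : padicCoeffIntegers S, φ (C (C a)) = C a)
    (hX : φ X = X) {r : PowerSeries (IwasawaAlgebraO S)} (hr : IsUnit (φ r)) : IsUnit r := by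
  have h := (isUnit_map_iff_isUnit_constantCoeff_constantCoeff hb φ hφf hC hX r).mp hr
  exact PowerSeries.isUnit_iff_constantCoeff.mpr (PowerSeries.isUnit_iff_constantCoeff.mpr h)

end Small

/-! ## §2 The v15 consumer -/

section E2

variable {p : ℕ} [Fact p.Prime] {S : Set (PadicAlgCl p)} [Algebra (IwasawaAlgebra p) (IwasawaAlgebraO S)]

set_option maxHeartbeats 400000 in -- same budget line as p780454's `charRoad_E2_of_roadD_junction_exact`
/-- ★★★★★ **E2 from road D + the junction, frame assembled (the v15 consumer).** With `ζ̄ := zetaSp f D a` and `z := j₀ (s ζ̄)`: `hz` from `Function.Exact j₀ gX`,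
`hζ` from `IsUnit (φ (D.nsub a))` (g19), `D.Z = D.cyclic a` (g19, via `isUnit_of_isUnit_map`), `z ≠ 0` from (an) + `hCol` (as in the glue), `hdef` from `H1[f] = 0` (p777666 with
`eH := j₀ ∘ s`), `hreg` derived (p782187); then p782187's `charRoad_E2_of_roadD_junction_exact_of_torsionBy_eq_bot`. Remaining HYPOTHESES = BRIEF-E2 rev 5's open rows:
J1 `B`, J2 `s`/`htB`/`hcoker`, J3 `j₀`/`hexact`, J4 `hY`, (4′) `H1[f] = 0` ⟸ `hTF`, (5′) `Col`, (7′) `hCol`, plus honda's datum `D`/`h52` and the unit index `a`/`ha` (p782069).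
[cite: Kobayashi2003, Thm. 7.3 i)] [cite: JohnsonLeungKings2011, Thm. 5.2, Cor. 5.3, §5.2] [cite: PollackRubin2004, §6–§7] [cite: Washington1997, §13.2] -/
theorem charRoad_E2_of_roadD_junction_of_isUnit_nsub [IsLocalRing (padicCoeffIntegers S)] (hS : 0 < Module.finrank ℚ_[p] (padicCoeffField S))
    (halg : ∀ r : IwasawaAlgebra p, algebraMap (IwasawaAlgebra p) (IwasawaAlgebraO S) r = iwasawaToIwasawaO S r)
    {M : ℕ} [NeZero M] (g : CuspForm (Gamma0 M) 2) (ι : coeffField g →+* PadicAlgCl p) (hng : IsNewform0 g)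
    (S₀ : Finset (HeightOneSpectrum (𝓞 ℚ)))
    {Q X' : Type} [AddCommGroup Q] [AddCommGroup X'] [Module (IwasawaAlgebraO S) Q] [Module (IwasawaAlgebra p) Q]
    [IsScalarTower (IwasawaAlgebra p) (IwasawaAlgebraO S) Q] [Module (IwasawaAlgebraO S) X'] [Module (IwasawaAlgebra p) X']
    [IsScalarTower (IwasawaAlgebra p) (IwasawaAlgebraO S) X'] [Module.Finite (IwasawaAlgebra p) X'] (hX' : Module.IsTorsion (IwasawaAlgebra p) X')
    (gX : Q →ₗ[IwasawaAlgebraO S] X') (b : padicCoeffIntegers S)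
    (hb : b ∈ IsLocalRing.maximalIdeal (padicCoeffIntegers S)) (φ : PowerSeries (IwasawaAlgebraO S) →+* IwasawaAlgebraO S)
    (hφf : φ (C (X - C b)) = 0) (hC : ∀ a : padicCoeffIntegers S, φ (C (C a)) = C a) (hX : φ X = X)
    (hker : RingHom.ker φ = Ideal.span {C (X - C b)})
    {Aidx H0 H1 H2 : Type v} [AddCommGroup H0]
    [Module (PowerSeries (IwasawaAlgebraO S)) H0] [AddCommGroup H1] [Module (PowerSeries (IwasawaAlgebraO S)) H1] [AddCommGroup H2]
    [Module (PowerSeries (IwasawaAlgebraO S)) H2] [Module.Finite (PowerSeries (IwasawaAlgebraO S)) H1]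
    [Module.Finite (PowerSeries (IwasawaAlgebraO S)) H2]
    (D : ZetaSkeleton (PowerSeries (IwasawaAlgebraO S)) Aidx H0 H1 H2) (h52 : D.Thm52Shape)
    (hH1 : Submodule.torsionBy (PowerSeries (IwasawaAlgebraO S)) H1 (C (X - C b)) = ⊥) (a : Aidx) (ha : IsUnit (φ (D.nsub a)))
    [Module (IwasawaAlgebraO S) (QuotSMulTop (C (X - C b) : PowerSeries (IwasawaAlgebraO S)) H1)]
    (hιH : ∀ (l : IwasawaAlgebraO S) (x : QuotSMulTop (C (X - C b) : PowerSeries (IwasawaAlgebraO S)) H1),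
      l • x = (PowerSeries.map (PowerSeries.C : padicCoeffIntegers S →+* IwasawaAlgebraO S) l) • x)
    [Module (IwasawaAlgebra p) (QuotSMulTop (C (X - C b) : PowerSeries (IwasawaAlgebraO S)) H1)]
    [IsScalarTower (IwasawaAlgebra p) (IwasawaAlgebraO S) (QuotSMulTop (C (X - C b) : PowerSeries (IwasawaAlgebraO S)) H1)]
    [Module (IwasawaAlgebra p) (Submodule.torsionBy (PowerSeries (IwasawaAlgebraO S)) H2 (C (X - C b)))]
    (hΛT : ∀ (r : IwasawaAlgebra p) (x : Submodule.torsionBy (PowerSeries (IwasawaAlgebraO S)) H2 (C (X - C b))),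
      r • x = (PowerSeries.map (PowerSeries.C : padicCoeffIntegers S →+* IwasawaAlgebraO S) (iwasawaToIwasawaO S r)) • x)
    [Module (IwasawaAlgebra p) (QuotSMulTop (C (X - C b) : PowerSeries (IwasawaAlgebraO S)) H2)]
    (hΛ2 : ∀ (r : IwasawaAlgebra p) (x : QuotSMulTop (C (X - C b) : PowerSeries (IwasawaAlgebraO S)) H2),
      r • x = (PowerSeries.map (PowerSeries.C : padicCoeffIntegers S →+* IwasawaAlgebraO S) (iwasawaToIwasawaO S r)) • x)
    {B : Type w} [AddCommGroup B] [Module (IwasawaAlgebraO S) B] [Module (IwasawaAlgebra p) B] [IsScalarTower (IwasawaAlgebra p) (IwasawaAlgebraO S) B]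
    (s : QuotSMulTop (C (X - C b) : PowerSeries (IwasawaAlgebraO S)) H1 →ₗ[IwasawaAlgebraO S] B)
    [Module.Finite (IwasawaAlgebra p) (B ⧸ LinearMap.range s)] (htB : Module.IsTorsion (IwasawaAlgebra p) (B ⧸ LinearMap.range s))
    (hcoker : lambdaInvariant p (B ⧸ LinearMap.range s) ≤ lambdaInvariant p (Submodule.torsionBy (PowerSeries (IwasawaAlgebraO S)) H2 (C (X - C b))))
    (j₀ : B →ₗ[IwasawaAlgebraO S] Q) (hexact : Function.Exact j₀ gX)
    (hY : lambdaInvariant p (QuotSMulTop (C (X - C b) : PowerSeries (IwasawaAlgebraO S)) H2) ≤ lambdaInvariant p (X' ⧸ LinearMap.range gX))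
    (Col : Q ≃ₗ[IwasawaAlgebraO S] IwasawaAlgebraO S) (L : IwasawaAlgebraO (Set.range ι)) (hL : L ≠ 0) {c : PadicAlgCl p} (hc : c ≠ 0)
    (fv : HeightOneSpectrum (𝓞 ℚ) → ℤ_[p]) (hfv : ∀ v ∈ S₀, fv v ≠ 0 ∧ (fv v).valuation = (frobeniusExponent p (natGenerator v : ℤ_[p])).valuation)
    (hCol : iwasawaOToPowerSeries S (Col (j₀ (s (zetaSp (C (X - C b) : PowerSeries (IwasawaAlgebraO S)) D a)))) =
      PowerSeries.C c * iwasawaOToPowerSeries (Set.range ι) L *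
        ∏ v ∈ S₀, Polynomial.aeval (PowerSeries.C ((natGenerator v : PadicAlgCl p)⁻¹) *
            (PowerSeries.binomialSeries ℤ_[p] (fv v)).map (algebraMap ℤ_[p] (PadicAlgCl p)))
          (1 - Polynomial.C (embCoeff g ι (natGenerator v)) * Polynomial.X +
            (if natGenerator v ∣ M then 0 else Polynomial.C (natGenerator v : PadicAlgCl p)) * Polynomial.X ^ 2)) :
    ∃ d : ℕ, (∀ k : ℕ, ‖PowerSeries.coeff k (iwasawaOToPowerSeries (Set.range ι) L)‖ ≤
        ‖PowerSeries.coeff d (iwasawaOToPowerSeries (Set.range ι) L)‖) ∧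
      (∀ k : ℕ, k < d → ‖PowerSeries.coeff k (iwasawaOToPowerSeries (Set.range ι) L)‖ <
        ‖PowerSeries.coeff d (iwasawaOToPowerSeries (Set.range ι) L)‖) ∧
      Module.finrank ℚ_[p] (padicCoeffField S) * (d + ∑ v ∈ S₀, p ^ (frobeniusExponent p (natGenerator v : ℤ_[p])).valuation *
        layerLambda ((1 - Polynomial.C (embCoeff g ι (natGenerator v)) * Polynomial.X +
          (if natGenerator v ∣ M then 0 else Polynomial.C (natGenerator v : PadicAlgCl p)) * Polynomial.X ^ 2).comp
            (Polynomial.C ((natGenerator v : PadicAlgCl p)⁻¹) * (Polynomial.X + 1)))) ≤ lambdaInvariant p X' := by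
  haveI : FiniteDimensional ℚ_[p] (padicCoeffField S) := Module.finite_of_finrank_pos hS
  haveI : IsDiscreteValuationRing (padicCoeffIntegers S) := by
    rw [padicCoeffIntegers_eq_unitBall S]; exact LambdaLowerBoundO.isDiscreteValuationRing_unitBall p _
  -- the specialised zeta class and its image in `Q`
  set ζ : QuotSMulTop (C (X - C b) : PowerSeries (IwasawaAlgebraO S)) H1 := zetaSp (C (X - C b) : PowerSeries (IwasawaAlgebraO S)) D a with hζdef
  set z : Q := j₀ (s ζ) with hzdef
  have hz : gX z = 0 := (hexact z).mpr ⟨s ζ, rfl⟩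
  have hζ : (D.Z).map ((C (X - C b) : PowerSeries (IwasawaAlgebraO S)) • (⊤ : Submodule (PowerSeries (IwasawaAlgebraO S)) H1)).mkQ =
      Submodule.span (PowerSeries (IwasawaAlgebraO S)) {ζ} :=
    map_mkQ_Z_eq_span_zetaSp_of_isUnit b φ hC hX hker D a ha
  have hZ : D.Z = D.cyclic a := Z_eq_cyclic_of_isUnit D a (isUnit_of_isUnit_map hb φ hφf hC hX ha)
  -- `Q ≅ Λ_𝒪` is torsion-free
  haveI : NoZeroSMulDivisors (IwasawaAlgebraO S) Q := by
    refine ⟨fun {c x} h ↦ ?_⟩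
    have h' : c * Col x = 0 := by rw [← smul_eq_mul, ← map_smul, h, map_zero]
    exact (mul_eq_zero.mp h').imp_right fun hx ↦ Col.injective (by rw [hx, map_zero])
  -- `z ≠ 0` from (an)
  haveI : FiniteDimensional ℚ (coeffField g) := IsNewform0.finiteDimensional_coeffField_holds hng
  haveI : FiniteDimensional ℚ_[p] (padicCoeffField (Set.range ι)) := GreenbergSelmer.finiteDimensional_padicCoeffField ι
  have hz0 : z ≠ 0 := by
    obtain ⟨d, hle, hlt⟩ := SmallImageRttE2Num.exists_normLambda_iwasawaAlgebraO p (Set.range ι) L hL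
    have hL' : iwasawaOToPowerSeries (Set.range ι) L ≠ 0 :=
      (map_ne_zero_iff _ (iwasawaOToPowerSeries_injective _)).mpr hL
    have hP : ∀ v ∈ S₀, (1 - Polynomial.C (embCoeff g ι (natGenerator v)) * Polynomial.X +
        (if natGenerator v ∣ M then 0 else Polynomial.C (natGenerator v : PadicAlgCl p)) * Polynomial.X ^ 2) ≠ 0 :=
      fun v _ h0 ↦ by
        have h1 := congrArg (fun P : Polynomial (PadicAlgCl p) ↦ P.coeff 0) h0
        simp only [Polynomial.coeff_add, Polynomial.coeff_sub, Polynomial.coeff_one_zero, Polynomial.coeff_C_mul,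
          Polynomial.coeff_X_zero, mul_zero, sub_zero, Polynomial.coeff_zero] at h1
        split_ifs at h1 with hd
        · simp only [zero_mul, Polynomial.coeff_zero, add_zero, one_ne_zero] at h1
        · simp only [Polynomial.coeff_C_mul, Polynomial.coeff_X_pow, mul_ite, mul_one, mul_zero] at h1
          norm_num at h1
    have hu : ∀ v ∈ S₀, ((natGenerator v : PadicAlgCl p))⁻¹ ≠ 0 := fun v _ ↦
      inv_ne_zero (Nat.cast_ne_zero.mpr (prime_natGenerator v).ne_zero)
    have hColz : Col z ≠ 0 := ne_zero_of_eulerProduct S S₀ hc hL' hle hlt _ _ fv hP hu (fun v hv ↦ (hfv v hv).1) hCol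
    intro h0
    exact hColz (by rw [h0, map_zero])
  -- `hdef` from `H1[f] = 0` through `eH := j₀ ∘ s`
  have hdef : Submodule.torsionBy (PowerSeries (IwasawaAlgebraO S)) (H1 ⧸ D.Z) (C (X - C b)) = ⊥ :=
    torsionBy_quotient_Z_eq_bot_of_quotSMulTop_linearMap b φ hC hX hker D a hZ hH1 hιH (j₀ ∘ₗ s) (by simpa only [LinearMap.comp_apply] using hz0)
  exact charRoad_E2_of_roadD_junction_exact_of_torsionBy_eq_bot hS halg g ι hng S₀ hX' gX z hz b φ hφf hC hX hker D h52 hdef hιH hΛT hΛ2 ζ hζ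
    s htB hcoker j₀ hexact rfl hY Col L hL hc fv hfv hCol

end E2

end Summit.BirchSwinnertonDyer.BirchSwinnertonDyer.Theorems.SmallImageRttCharRoad

end
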